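import Mathlib

/-!
# Balanced transport minimises the ladder condition number (solo-blind, steady door §24.46(6)–24.47)

Two-component WKB along a closed loop `Λ(s)` of the fibre Floquet landscape gives, for a
Bohr–Sommerfeld rung, the pencil condition number
`κ = (⟨k_F e^{2F}⟩_τ · ⟨k_F e^{-2F}⟩_τ)^{1/2}`, where `k_F ≥ 0` is the fibre Floquet
condition number, `F` the non-Hermitian amplitude drift and `⟨·⟩_τ` the closed-orbit time
average (weights `w = dτ ≥ 0`).  By Cauchy–Schwarz `κ ≥ ⟨k_F⟩_τ` for EVERY drift `F`, with
equality for balanced transport (`F` constant).  This file records the discrete (quadrature)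
form of that inequality, which is what the loop functional of `work/loops/fibre.py` computes:
the balanced prediction `⟨k_F⟩_τ` is a lower bound for the WKB condition number, so a
measured excess `κ_p/⟨k_F⟩_τ - 1 ≥ 0` is the signature of drift (data: 1.01–1.21 on six rungs).
-/

namespace Summit.AnomalousDissipation.AnomalousDissipation.Theorems

open Finset Real

/-- Cauchy–Schwarz form of "balanced transport minimises κ": for weights `w ≥ 0`,
a profile `k ≥ 0` and any drift `F`,
`(∑ w k)^2 ≤ (∑ w k e^{2F}) (∑ w k e^{-2F})`. -/
theorem balanced_transport_lower_bound {ι : Type*} (s : Finset ι) (w k F : ι → ℝ)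
    (hw : ∀ i ∈ s, 0 ≤ w i) (hk : ∀ i ∈ s, 0 ≤ k i) :
    (∑ i ∈ s, w i * k i) ^ 2 ≤
      (∑ i ∈ s, w i * k i * exp (2 * F i)) * (∑ i ∈ s, w i * k i * exp (-(2 * F i))) := by
  have hcs := Finset.sum_mul_sq_le_sq_mul_sq s (fun i ↦ sqrt (w i * k i) * exp (F i))
    (fun i ↦ sqrt (w i * k i) * exp (-F i))
  have h1 : ∑ i ∈ s, (sqrt (w i * k i) * exp (F i)) * (sqrt (w i * k i) * exp (-F i))
      = ∑ i ∈ s, w i * k i := by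
    refine sum_congr rfl fun i hi ↦ ?_
    have hwk : 0 ≤ w i * k i := mul_nonneg (hw i hi) (hk i hi)
    calc sqrt (w i * k i) * exp (F i) * (sqrt (w i * k i) * exp (-F i))
        = (sqrt (w i * k i) * sqrt (w i * k i)) * (exp (F i) * exp (-F i)) := by ring
      _ = w i * k i := by rw [mul_self_sqrt hwk, ← exp_add, add_neg_cancel, exp_zero, mul_one]
  have h2 : ∑ i ∈ s, (sqrt (w i * k i) * exp (F i)) ^ 2 = ∑ i ∈ s, w i * k i * exp (2 * F i) := by
    refine sum_congr rfl fun i hi ↦ ?_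
    have hwk : 0 ≤ w i * k i := mul_nonneg (hw i hi) (hk i hi)
    rw [mul_pow, sq_sqrt hwk, ← exp_nat_mul]
    norm_num
  have h3 : ∑ i ∈ s, (sqrt (w i * k i) * exp (-F i)) ^ 2
      = ∑ i ∈ s, w i * k i * exp (-(2 * F i)) := by
    refine sum_congr rfl fun i hi ↦ ?_
    have hwk : 0 ≤ w i * k i := mul_nonneg (hw i hi) (hk i hi)
    rw [mul_pow, sq_sqrt hwk, ← exp_nat_mul]
    congr 1; congr 1; push_cast; ring
  rw [h1, h2, h3] at hcs
  exact hcs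

/-- Normalised form: with total weight `T = ∑ w > 0`, the balanced prediction `⟨k⟩_τ` is a
lower bound for the drifted condition number `(⟨k e^{2F}⟩_τ ⟨k e^{-2F}⟩_τ)^{1/2}`. -/
theorem mean_le_sqrt_drifted_means {ι : Type*} (s : Finset ι) (w k F : ι → ℝ)
    (hw : ∀ i ∈ s, 0 ≤ w i) (hk : ∀ i ∈ s, 0 ≤ k i) (hT : 0 < ∑ i ∈ s, w i) :
    (∑ i ∈ s, w i * k i) / (∑ i ∈ s, w i) ≤
      sqrt (((∑ i ∈ s, w i * k i * exp (2 * F i)) / (∑ i ∈ s, w i)) *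
            ((∑ i ∈ s, w i * k i * exp (-(2 * F i))) / (∑ i ∈ s, w i))) := by
  have hnum : 0 ≤ ∑ i ∈ s, w i * k i := sum_nonneg fun i hi ↦ mul_nonneg (hw i hi) (hk i hi)
  have hlhs : 0 ≤ (∑ i ∈ s, w i * k i) / (∑ i ∈ s, w i) := div_nonneg hnum hT.le
  have hcs := balanced_transport_lower_bound s w k F hw hk
  have key : ((∑ i ∈ s, w i * k i) / (∑ i ∈ s, w i)) ^ 2 ≤
      ((∑ i ∈ s, w i * k i * exp (2 * F i)) / (∑ i ∈ s, w i)) *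
        ((∑ i ∈ s, w i * k i * exp (-(2 * F i))) / (∑ i ∈ s, w i)) := by
    rw [div_pow, div_mul_div_comm, ← sq]
    exact div_le_div_of_nonneg_right hcs (sq_nonneg _)
  calc (∑ i ∈ s, w i * k i) / (∑ i ∈ s, w i)
      = sqrt (((∑ i ∈ s, w i * k i) / (∑ i ∈ s, w i)) ^ 2) := (sqrt_sq hlhs).symm
    _ ≤ _ := sqrt_le_sqrt key

end Summit.AnomalousDissipation.AnomalousDissipation.Theorems
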